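import Summits.ABC.StewartYu.PadicG3OddCeilings
import Summits.ABC.StewartYu.PadicG3OddLogForm
import Summits.ABC.StewartYu.PadicG3RecordR3
import HarnessLib

/-!
# Cell abc-stewartyu, crux `Y07Odd` (stmt-ABC-19658), line `gen3-slab-odd`: the record's four step FAMILIES of `IneqPackR₂/R₃` FROM
# LOGARITHMIC LINES over an abstract schedule `Sc : G3Sched n` (generic layer, part 2b)

`Summits/ABC/StewartYu/PadicG3OddLines.lean` — cell `abc-stewartyu` (HOME `run/shared/lean/pub/abc-stewartyu/`), seat p5 (g4); sequel to
`PadicG3OddLogForm` (part 1) and `PadicG3SupplyHalfSharp` ((S1), route-holder ruling R22).  Theorems only; no named fact; no numbers.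

For an odd prime `p`, a Gen-3 datum `S`, a schedule `Sc` (print box `sideS₂ = ⌊Lbox/(2Aⱼ)⌋`, unknowns `UcardS₂`, Siegel size `PmaxS₂`) and ONE
smallness exponent `E` with `‖Λ/b_{j₀}‖ ≤ p^{−E}`:
* **`hK0_of_lines`**, **`hO_of_lines`**, **`hK_of_lines`** — the level-`0` / odd-node / symmetric k-step families (conjuncts 2, 4, 5 of `IneqPackR₂`,
  unchanged in `IneqPackR₃`) from, per `(lev, ν)`, the exponent line `⌊(t−1)/2⌋ + condExp + m·g + ⌈g/2⌉ ≤ E` and the gain line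
  `log BwP + log KC(…, x₁, τ) < g·(m+½)·log p` (`g` = the family's zeros count `(2N+1)·t`, resp. `2N·t` at the odd nodes);
* **`ineqPackR₃_of_lines`** — the whole pack `IneqPackR₃ S Sc` (p2-g4's `PadicG3RecordR3`) from (B1), ONE exponent and the eight lines;
* **`hH_of_lines`** — the Kummer half-step family in the SHARP currency (`DCs`, `MhCs` of `PadicG3SupplyHalfSharp`; conjunct 3 of `IneqPackR₃`)
  from the exponent line and the gain line `log BwP + 2^{n+1}·(log 4 + 2 log DCs + log(1 + U·P·MhCs) + 3 log ∏H(α)) − log DCs < g·(m+½)·log p`;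
* the slot ceilings the instantiations bound are in `PadicG3OddCeilings` (part 2a).

WHAT THIS IS NOT: (B1) (lp-1's `startCountR₂_*`); the exponent `E` (headlines, p1/lp-1); the slot bounds in `Z`-currency (Part A, p1 g8 / p3-g7);
no crux moves.

References: Yu. V. Nesterenko, LNM 1819 (2003) §4.2 (4.29)–(4.35), §4.3 (4.39)–(4.45); K. Yu, Acta Math. 211 (2013) Lemma 5.2.
-/

noncomputable section

open NormedSpace Finset Polynomial
open Literature.NumberTheory.Transcendental
open Literature.NumberTheory.Transcendental.PadicCW77 (condExp)
open Literature.NumberTheory.Transcendental.CW77.Setup (Tau tauNorm)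
open scoped Nat

namespace Summit.ABC.StewartYu

namespace G3Setup

variable {p : ℕ} [Fact p.Prime] (S : G3Setup p) (Sc : G3Sched S.n)

/-! ### The three k-step families from their lines -/

/-- **The level-`0` k-steps (`hK0`) from their lines.** [cite: Nesterenko2003, §4.2 (4.29)–(4.33); shape only] -/
theorem hK0_of_lines {E : ℕ} (hΛ : ‖S.Λ / (S.b S.j₀ : ℚ_[p])‖ ≤ ((p : ℝ) ^ E)⁻¹)
    (hexp : ∀ ν < S.n, (S.tS Sc 0 - 1) / 2 + condExp p (2 * S.NS Sc 0 ν + 1) (S.tS Sc 0) +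
      Sc.m * ((2 * S.NS Sc 0 ν + 1) * S.tS Sc 0) + ((2 * S.NS Sc 0 ν + 1) * S.tS Sc 0 + 1) / 2 ≤ E)
    (hgain : ∀ ν < S.n, ∀ x₁ : ℤ, |x₁| ≤ (S.NS Sc 0 (ν + 1) : ℤ) → ∀ τ : Tau S.n, tauNorm τ + S.tS Sc 0 ≤ S.TordS Sc 0 ν →
      Real.log (BwP (p := p) Sc.L₀ Sc.m) + Real.log (S.KC (S.UcardS₂ Sc) (S.PmaxS₂ Sc) Sc.L₀ Sc.H Sc.Sd 0 (S.Lb (S.sideS₂ Sc) 0) x₁ τ) <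
        (((2 * S.NS Sc 0 ν + 1) * S.tS Sc 0 : ℕ) : ℝ) * (((Sc.m : ℝ) + 1 / 2) * Real.log p)) :
    ∀ ν < S.n, ∀ x₁ : ℤ, |x₁| ≤ (S.NS Sc 0 (ν + 1) : ℤ) → ∀ τ : Tau S.n, tauNorm τ + S.tS Sc 0 ≤ S.TordS Sc 0 ν →
      max (BwP (p := p) Sc.L₀ Sc.m * ‖S.Λ / (S.b S.j₀ : ℚ_[p])‖ * (p : ℝ) ^ ((S.tS Sc 0 - 1) / 2) *
            (p : ℝ) ^ condExp p (2 * S.NS Sc 0 ν + 1) (S.tS Sc 0))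
        (BwP (p := p) Sc.L₀ Sc.m / ((p : ℝ) ^ Sc.m * Real.sqrt p) ^ ((2 * S.NS Sc 0 ν + 1) * S.tS Sc 0)) <
      1 / S.KC (S.UcardS₂ Sc) (S.PmaxS₂ Sc) Sc.L₀ Sc.H Sc.Sd 0 (S.Lb (S.sideS₂ Sc) 0) x₁ τ := by
  intro ν hν x₁ hx₁ τ hτ
  exact G3OddLog.kstep_max_lt_of_lines S.one_lt_p (BwP_pos Sc.L₀ Sc.m)
    (lt_of_lt_of_le zero_lt_one (S.one_le_KC _ (S.PmaxS₂_nonneg Sc) _ _ _ _ _ _ _)) hΛ (hexp ν hν) (hgain ν hν x₁ hx₁ τ hτ)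

/-- **The odd-node k-steps (`hO`, first step of each level `≥ 1`) from their lines.** [cite: Nesterenko2003, §4.2; shape only] -/
theorem hO_of_lines {E : ℕ} (hΛ : ‖S.Λ / (S.b S.j₀ : ℚ_[p])‖ ≤ ((p : ℝ) ^ E)⁻¹)
    (hexp : ∀ lev < Sc.Sd, (S.tS Sc (lev + 1) - 1) / 2 + condExp p (2 * S.NhS Sc (lev + 1)) (S.tS Sc (lev + 1)) +
      Sc.m * ((2 * S.NhS Sc (lev + 1)) * S.tS Sc (lev + 1)) + ((2 * S.NhS Sc (lev + 1)) * S.tS Sc (lev + 1) + 1) / 2 ≤ E)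
    (hgain : ∀ lev < Sc.Sd, ∀ x₁ : ℤ, |x₁| ≤ (S.NS Sc (lev + 1) 1 : ℤ) → ∀ τ : Tau S.n, tauNorm τ + S.tS Sc (lev + 1) ≤ S.TordS Sc (lev + 1) 0 →
      Real.log (BwP (p := p) Sc.L₀ Sc.m) +
        Real.log (S.KC (S.UcardS₂ Sc) (S.PmaxS₂ Sc) Sc.L₀ Sc.H Sc.Sd (lev + 1) (S.Lb (S.sideS₂ Sc) (lev + 1)) x₁ τ) <
        (((2 * S.NhS Sc (lev + 1)) * S.tS Sc (lev + 1) : ℕ) : ℝ) * (((Sc.m : ℝ) + 1 / 2) * Real.log p)) :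
    ∀ lev < Sc.Sd, ∀ x₁ : ℤ, |x₁| ≤ (S.NS Sc (lev + 1) 1 : ℤ) → ∀ τ : Tau S.n, tauNorm τ + S.tS Sc (lev + 1) ≤ S.TordS Sc (lev + 1) 0 →
      max (BwP (p := p) Sc.L₀ Sc.m * ‖S.Λ / (S.b S.j₀ : ℚ_[p])‖ * (p : ℝ) ^ ((S.tS Sc (lev + 1) - 1) / 2) *
            (p : ℝ) ^ condExp p (2 * S.NhS Sc (lev + 1)) (S.tS Sc (lev + 1)))
        (BwP (p := p) Sc.L₀ Sc.m / ((p : ℝ) ^ Sc.m * Real.sqrt p) ^ ((2 * S.NhS Sc (lev + 1)) * S.tS Sc (lev + 1))) <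
      1 / S.KC (S.UcardS₂ Sc) (S.PmaxS₂ Sc) Sc.L₀ Sc.H Sc.Sd (lev + 1) (S.Lb (S.sideS₂ Sc) (lev + 1)) x₁ τ := by
  intro lev hlev x₁ hx₁ τ hτ
  exact G3OddLog.kstep_max_lt_of_lines S.one_lt_p (BwP_pos Sc.L₀ Sc.m)
    (lt_of_lt_of_le zero_lt_one (S.one_le_KC _ (S.PmaxS₂_nonneg Sc) _ _ _ _ _ _ _)) hΛ (hexp lev hlev) (hgain lev hlev x₁ hx₁ τ hτ)

/-- **The symmetric k-steps of the levels `≥ 1` (`hK`) from their lines.** [cite: Nesterenko2003, §4.2; shape only] -/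
theorem hK_of_lines {E : ℕ} (hΛ : ‖S.Λ / (S.b S.j₀ : ℚ_[p])‖ ≤ ((p : ℝ) ^ E)⁻¹)
    (hexp : ∀ lev < Sc.Sd, ∀ ν, 1 ≤ ν → ν < S.n → (S.tS Sc (lev + 1) - 1) / 2 + condExp p (2 * S.NS Sc (lev + 1) ν + 1) (S.tS Sc (lev + 1)) +
      Sc.m * ((2 * S.NS Sc (lev + 1) ν + 1) * S.tS Sc (lev + 1)) + ((2 * S.NS Sc (lev + 1) ν + 1) * S.tS Sc (lev + 1) + 1) / 2 ≤ E)
    (hgain : ∀ lev < Sc.Sd, ∀ ν, 1 ≤ ν → ν < S.n → ∀ x₁ : ℤ, |x₁| ≤ (S.NS Sc (lev + 1) (ν + 1) : ℤ) →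
      ∀ τ : Tau S.n, tauNorm τ + S.tS Sc (lev + 1) ≤ S.TordS Sc (lev + 1) ν →
      Real.log (BwP (p := p) Sc.L₀ Sc.m) +
        Real.log (S.KC (S.UcardS₂ Sc) (S.PmaxS₂ Sc) Sc.L₀ Sc.H Sc.Sd (lev + 1) (S.Lb (S.sideS₂ Sc) (lev + 1)) x₁ τ) <
        (((2 * S.NS Sc (lev + 1) ν + 1) * S.tS Sc (lev + 1) : ℕ) : ℝ) * (((Sc.m : ℝ) + 1 / 2) * Real.log p)) :
    ∀ lev < Sc.Sd, ∀ ν, 1 ≤ ν → ν < S.n → ∀ x₁ : ℤ, |x₁| ≤ (S.NS Sc (lev + 1) (ν + 1) : ℤ) →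
      ∀ τ : Tau S.n, tauNorm τ + S.tS Sc (lev + 1) ≤ S.TordS Sc (lev + 1) ν →
      max (BwP (p := p) Sc.L₀ Sc.m * ‖S.Λ / (S.b S.j₀ : ℚ_[p])‖ * (p : ℝ) ^ ((S.tS Sc (lev + 1) - 1) / 2) *
            (p : ℝ) ^ condExp p (2 * S.NS Sc (lev + 1) ν + 1) (S.tS Sc (lev + 1)))
        (BwP (p := p) Sc.L₀ Sc.m / ((p : ℝ) ^ Sc.m * Real.sqrt p) ^ ((2 * S.NS Sc (lev + 1) ν + 1) * S.tS Sc (lev + 1))) <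
      1 / S.KC (S.UcardS₂ Sc) (S.PmaxS₂ Sc) Sc.L₀ Sc.H Sc.Sd (lev + 1) (S.Lb (S.sideS₂ Sc) (lev + 1)) x₁ τ := by
  intro lev hlev ν hν1 hνn x₁ hx₁ τ hτ
  exact G3OddLog.kstep_max_lt_of_lines S.one_lt_p (BwP_pos Sc.L₀ Sc.m)
    (lt_of_lt_of_le zero_lt_one (S.one_le_KC _ (S.PmaxS₂_nonneg Sc) _ _ _ _ _ _ _)) hΛ (hexp lev hlev ν hν1 hνn)
    (hgain lev hlev ν hν1 hνn x₁ hx₁ τ hτ)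

/-! ### The Kummer half-step family (sharp currency) from its lines -/

/-- **The Kummer half-steps (`hH`, sharp currency `DCs`/`MhCs`) from their lines.** [cite: Nesterenko2003, §4.3 (4.39)–(4.45); shape only] -/
theorem hH_of_lines {E : ℕ} (hΛ : ‖S.Λ / (S.b S.j₀ : ℚ_[p])‖ ≤ ((p : ℝ) ^ E)⁻¹)
    (hexp : ∀ lev < Sc.Sd, (S.tS Sc lev - 1) / 2 + condExp p (2 * S.NS Sc lev S.n + 1) (S.tS Sc lev) +
      Sc.m * ((2 * S.NS Sc lev S.n + 1) * S.tS Sc lev) + ((2 * S.NS Sc lev S.n + 1) * S.tS Sc lev + 1) / 2 ≤ E)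
    (hgain : ∀ lev < Sc.Sd, ∀ s₁ : ℤ, Odd s₁ → |s₁| ≤ (2 * S.NhS Sc (lev + 1) - 1 : ℤ) → ∀ τ : Tau S.n, tauNorm τ + S.tS Sc lev ≤ S.TordS Sc lev S.n →
      Real.log (BwP (p := p) Sc.L₀ Sc.m) +
          (((2 ^ (S.n + 1) : ℕ) : ℝ)) * (Real.log 4 + 2 * Real.log (S.DCs (S.Lb (S.sideS₂ Sc) lev) Sc.H s₁ τ : ℝ) +
            Real.log (1 + (S.UcardS₂ Sc : ℝ) * (S.PmaxS₂ Sc) * S.MhCs (S.Lb (S.sideS₂ Sc) lev) Sc.L₀ Sc.H Sc.Sd lev s₁ τ) +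
            3 * Real.log (CW77.heightProd S.α)) -
          Real.log (S.DCs (S.Lb (S.sideS₂ Sc) lev) Sc.H s₁ τ : ℝ) <
        (((2 * S.NS Sc lev S.n + 1) * S.tS Sc lev : ℕ) : ℝ) * (((Sc.m : ℝ) + 1 / 2) * Real.log p)) :
    ∀ lev < Sc.Sd, ∀ s₁ : ℤ, Odd s₁ → |s₁| ≤ (2 * S.NhS Sc (lev + 1) - 1 : ℤ) → ∀ τ : Tau S.n, tauNorm τ + S.tS Sc lev ≤ S.TordS Sc lev S.n →
      max (BwP (p := p) Sc.L₀ Sc.m * ‖S.Λ / (S.b S.j₀ : ℚ_[p])‖ * (p : ℝ) ^ ((S.tS Sc lev - 1) / 2) *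
            (p : ℝ) ^ condExp p (2 * S.NS Sc lev S.n + 1) (S.tS Sc lev))
        (BwP (p := p) Sc.L₀ Sc.m / ((p : ℝ) ^ Sc.m * Real.sqrt p) ^ ((2 * S.NS Sc lev S.n + 1) * S.tS Sc lev)) <
      (S.DCs (S.Lb (S.sideS₂ Sc) lev) Sc.H s₁ τ : ℝ) /
        (4 * (S.DCs (S.Lb (S.sideS₂ Sc) lev) Sc.H s₁ τ : ℝ) ^ 2 *
          (1 + (S.UcardS₂ Sc : ℝ) * (S.PmaxS₂ Sc) * S.MhCs (S.Lb (S.sideS₂ Sc) lev) Sc.L₀ Sc.H Sc.Sd lev s₁ τ) *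
          CW77.heightProd S.α ^ 3) ^ (2 ^ (S.n + 1)) := by
  intro lev hlev s₁ hs₁ hs₁' τ hτ
  have hD : (1 : ℝ) ≤ (S.DCs (S.Lb (S.sideS₂ Sc) lev) Sc.H s₁ τ : ℝ) := by exact_mod_cast S.one_le_DCs _ _ _ _
  have hQ : (0 : ℝ) ≤ (S.UcardS₂ Sc : ℝ) * (S.PmaxS₂ Sc) * S.MhCs (S.Lb (S.sideS₂ Sc) lev) Sc.L₀ Sc.H Sc.Sd lev s₁ τ := by
    have hP : (0 : ℝ) ≤ (S.PmaxS₂ Sc : ℝ) := by exact_mod_cast S.PmaxS₂_nonneg Sc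
    have hM := S.MhCs_nonneg (S.Lb (S.sideS₂ Sc) lev) Sc.L₀ Sc.H Sc.Sd lev s₁ τ
    positivity
  have hP : (1 : ℝ) ≤ CW77.heightProd S.α := CW77.one_le_heightProd S.α
  have h := G3OddLog.half_max_lt_of_lines (e := 2 ^ (S.n + 1)) S.one_lt_p (BwP_pos Sc.L₀ Sc.m) hD hQ hP hΛ (hexp lev hlev)
    (by have hg := hgain lev hlev s₁ hs₁ hs₁' τ hτ; push_cast at hg ⊢; exact hg)
  exact h

/-! ### The whole pack `IneqPackR₃` from (B1) and the lines -/

/-- **`IneqPackR₃ S Sc` from the Siegel count (B1), ONE smallness exponent and the four families' lines.**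
[cite: Nesterenko2003, Prop 4.1, Lemma 4.3, §4.3; shape only] -/
theorem ineqPackR₃_of_lines {E : ℕ} (hΛ : ‖S.Λ / (S.b S.j₀ : ℚ_[p])‖ ≤ ((p : ℝ) ^ E)⁻¹)
    (hB1 : 2 * (Icc (-(S.NS Sc 0 0 : ℤ)) (S.NS Sc 0 0) ×ˢ tauSetR S.n S.j₀ (S.TordS Sc 0 0)).card * ((p - 1) * p ^ Sc.m) ≤
      (Sc.L₀ + 1) * ∏ j, (2 * S.sideS₂ Sc j + 1))
    (hexpK0 : ∀ ν < S.n, (S.tS Sc 0 - 1) / 2 + condExp p (2 * S.NS Sc 0 ν + 1) (S.tS Sc 0) +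
      Sc.m * ((2 * S.NS Sc 0 ν + 1) * S.tS Sc 0) + ((2 * S.NS Sc 0 ν + 1) * S.tS Sc 0 + 1) / 2 ≤ E)
    (hgainK0 : ∀ ν < S.n, ∀ x₁ : ℤ, |x₁| ≤ (S.NS Sc 0 (ν + 1) : ℤ) → ∀ τ : Tau S.n, tauNorm τ + S.tS Sc 0 ≤ S.TordS Sc 0 ν →
      Real.log (BwP (p := p) Sc.L₀ Sc.m) + Real.log (S.KC (S.UcardS₂ Sc) (S.PmaxS₂ Sc) Sc.L₀ Sc.H Sc.Sd 0 (S.Lb (S.sideS₂ Sc) 0) x₁ τ) <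
        (((2 * S.NS Sc 0 ν + 1) * S.tS Sc 0 : ℕ) : ℝ) * (((Sc.m : ℝ) + 1 / 2) * Real.log p))
    (hexpH : ∀ lev < Sc.Sd, (S.tS Sc lev - 1) / 2 + condExp p (2 * S.NS Sc lev S.n + 1) (S.tS Sc lev) +
      Sc.m * ((2 * S.NS Sc lev S.n + 1) * S.tS Sc lev) + ((2 * S.NS Sc lev S.n + 1) * S.tS Sc lev + 1) / 2 ≤ E)
    (hgainH : ∀ lev < Sc.Sd, ∀ s₁ : ℤ, Odd s₁ → |s₁| ≤ (2 * S.NhS Sc (lev + 1) - 1 : ℤ) → ∀ τ : Tau S.n, tauNorm τ + S.tS Sc lev ≤ S.TordS Sc lev S.n →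
      Real.log (BwP (p := p) Sc.L₀ Sc.m) +
          (((2 ^ (S.n + 1) : ℕ) : ℝ)) * (Real.log 4 + 2 * Real.log (S.DCs (S.Lb (S.sideS₂ Sc) lev) Sc.H s₁ τ : ℝ) +
            Real.log (1 + (S.UcardS₂ Sc : ℝ) * (S.PmaxS₂ Sc) * S.MhCs (S.Lb (S.sideS₂ Sc) lev) Sc.L₀ Sc.H Sc.Sd lev s₁ τ) +
            3 * Real.log (CW77.heightProd S.α)) -
          Real.log (S.DCs (S.Lb (S.sideS₂ Sc) lev) Sc.H s₁ τ : ℝ) <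
        (((2 * S.NS Sc lev S.n + 1) * S.tS Sc lev : ℕ) : ℝ) * (((Sc.m : ℝ) + 1 / 2) * Real.log p))
    (hexpO : ∀ lev < Sc.Sd, (S.tS Sc (lev + 1) - 1) / 2 + condExp p (2 * S.NhS Sc (lev + 1)) (S.tS Sc (lev + 1)) +
      Sc.m * ((2 * S.NhS Sc (lev + 1)) * S.tS Sc (lev + 1)) + ((2 * S.NhS Sc (lev + 1)) * S.tS Sc (lev + 1) + 1) / 2 ≤ E)
    (hgainO : ∀ lev < Sc.Sd, ∀ x₁ : ℤ, |x₁| ≤ (S.NS Sc (lev + 1) 1 : ℤ) → ∀ τ : Tau S.n, tauNorm τ + S.tS Sc (lev + 1) ≤ S.TordS Sc (lev + 1) 0 →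
      Real.log (BwP (p := p) Sc.L₀ Sc.m) +
        Real.log (S.KC (S.UcardS₂ Sc) (S.PmaxS₂ Sc) Sc.L₀ Sc.H Sc.Sd (lev + 1) (S.Lb (S.sideS₂ Sc) (lev + 1)) x₁ τ) <
        (((2 * S.NhS Sc (lev + 1)) * S.tS Sc (lev + 1) : ℕ) : ℝ) * (((Sc.m : ℝ) + 1 / 2) * Real.log p))
    (hexpK : ∀ lev < Sc.Sd, ∀ ν, 1 ≤ ν → ν < S.n → (S.tS Sc (lev + 1) - 1) / 2 + condExp p (2 * S.NS Sc (lev + 1) ν + 1) (S.tS Sc (lev + 1)) +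
      Sc.m * ((2 * S.NS Sc (lev + 1) ν + 1) * S.tS Sc (lev + 1)) + ((2 * S.NS Sc (lev + 1) ν + 1) * S.tS Sc (lev + 1) + 1) / 2 ≤ E)
    (hgainK : ∀ lev < Sc.Sd, ∀ ν, 1 ≤ ν → ν < S.n → ∀ x₁ : ℤ, |x₁| ≤ (S.NS Sc (lev + 1) (ν + 1) : ℤ) →
      ∀ τ : Tau S.n, tauNorm τ + S.tS Sc (lev + 1) ≤ S.TordS Sc (lev + 1) ν →
      Real.log (BwP (p := p) Sc.L₀ Sc.m) +
        Real.log (S.KC (S.UcardS₂ Sc) (S.PmaxS₂ Sc) Sc.L₀ Sc.H Sc.Sd (lev + 1) (S.Lb (S.sideS₂ Sc) (lev + 1)) x₁ τ) <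
        (((2 * S.NS Sc (lev + 1) ν + 1) * S.tS Sc (lev + 1) : ℕ) : ℝ) * (((Sc.m : ℝ) + 1 / 2) * Real.log p)) :
    S.IneqPackR₃ Sc :=
  ⟨hB1, S.hK0_of_lines Sc hΛ hexpK0 hgainK0, S.hH_of_lines Sc hΛ hexpH hgainH, S.hO_of_lines Sc hΛ hexpO hgainO, S.hK_of_lines Sc hΛ hexpK hgainK⟩

end G3Setup

end Summit.ABC.StewartYu

end
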